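import Literature.MathematicalPhysics.QuantumFieldTheory.Balaban1983to89.Beta.GaugeFixing

/-!
# `BalabanUV.Beta.D1BFx.GramWeightDeterminant` — road «BF-x» for binder row D1, slot (K), X₃(ii) ROUTE T, brick **K-TA4G «GRAM FORM OF THE
# JET IDENTITY»** (`HOME/b2b-balaban-beta-d1-p2/K-ASSEMBLY-SPEC-v2.md` §2), PART 1 — THE DETERMINANT LEVEL: the linearised
# Faddeev–Popov determinant identity with a GENERAL co-frame weight `τ′ᵀ·A·τ′` and the slice change to the comb slice `τ`, its GRAM
# read-out `det(Wᵀ(τ′ᵀAτ′)W) = det(τ′W)²·det A`, the FRAME-FREE rank-`ρ` form (weight `B = Bᵀ` with `B·W·(WᵀBW)⁻¹·Wᵀ·B = B`), and the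
# real absolute ∕ logarithmic forms that the second-variation argument (`LogDetSecondVariation.secondVar_comb_eq_zero`) consumes

HONEST DEPENDENCY (cell records, verbatim): «continuum YM on T⁴ ⇐ BetaPertH ∧ nine spine estimates (0/9 proved); BetaPertH ⇐ (D1) ∧ (D4) ∧
CAP+tail; G-an2-4 gates asym, D1 and NE2/3/4.»  HONEST FRAMING (cell contract, verbatim): «discharging `BetaPertH` makes Bałaban's UV stability
UNCONDITIONAL — a real constructive-QFT result; it is NOT the continuum limit and NOT the Clay problem.»  THIS MODULE DISCHARGES NOTHING of (K),
of D1 or of the wall: [folklore] finite-dimensional linear algebra over the tree's `Beta.GaugeFixing` (`det_kkt_add_weight`,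
`det_kkt_fromRows_slice_change`) and `Beta.Composition` (`kkt`) BY NAME and Mathlib's `Matrix` API.  No definition, no `def … : Prop`, nothing
cited, no wall binder instantiated, 0 sorry.  NOT D1, NOT BetaPertH, NOT continuum, NOT Clay.

ABSOLUTE RULE (cell charter, verbatim): «No internally-minted statement may enter as a cited fact. Every hypothesis is either kernel-proved in this
package or a verbatim quotation of a PUBLISHED theorem with page reference. The manuscript(s) under audit are NOT citable for their own disputed
steps — they are the thing under adjudication; programme-internal (2001/route/tribunal) claims are never citable.»

WHY (K-ASSEMBLY-SPEC v2 §0 DECISION 2 and §2 K-TA4G; journal FINDING of this seat, 2026-08-20T22:06Z).  On the road the gauge-fixing weight of the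
N-side is `B = 2·dRδ` (second order), whose square root `P` (rows indexed by the comb bonds `ρ`) exists only through an orthonormal frame of
`range R(u)`; v2 therefore asks for the slice-transfer identity with the weight in GRAM FORM (`Φ := WᵀBW`).  As the FINDING records, the identity
with a general symmetric weight `B` is FALSE (a 2 × 2 witness: the degree count needs `rank B = |ρ|`); the rank-`ρ` structure must enter the
hypotheses.  This file supplies the determinant level in the two frame-free shapes: (R2) a co-frame factorisation `B = τ′ᵀ·A·τ′` with ANY
`ρ`-indexed `τ′` (`τ′W` invertible; on the road canonically `τ′ = NᵀΔ_Uδ_U`, `A = 2(NᵀΔ_U²N)⁻¹`, no frame, no square root), and (R1) the rank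
identity `B·W·Φ⁻¹·Wᵀ·B = B` (⟺ `rank B = |ρ|` given `det Φ ≠ 0`, `B = Bᵀ`), which IS (R2) at `τ′ := Φ⁻¹WᵀB`, `A := Φ` (then `τ′W = 1`).
CONTENT (every field `𝕜`; `ν`, `μ`, `ρ` finite; `K : ν×ν`, `Q : μ×ν`, comb slice `τ : ρ×ν`, gauge basis `W : ν×ρ`):
* §1 [folklore] **`det_kkt_add_weight_slice`**: `K·W = 0`, `Kᵀ·W = 0`, `Q·W = 0`, `τW`, `τ′W`, `A` invertible ⟹
  `det kkt (K + τ′ᵀAτ′) Q · det(τW)² = (−1)^{|ρ|}·det A·det(τ′W)²·det kkt K [Q; τ]`; `det_gram_coframe`: `det(Wᵀ(τ′ᵀAτ′)W) = det(τ′W)²·det A`;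
  hence **`det_kkt_add_weight_slice_gram`**: `… = (−1)^{|ρ|}·det(Wᵀ(τ′ᵀAτ′)W)·det kkt K [Q; τ]`.
* §2 [folklore] **`det_kkt_add_rankWeight`**: `Bᵀ = B`, `det(WᵀBW)` invertible, `B·W·(WᵀBW)⁻¹·Wᵀ·B = B`, order-0 Ward (`K·W = 0`, `Kᵀ·W = 0`,
  `Q·W = 0`), `τW` invertible ⟹ `det kkt (K + B) Q · det(τW)² = (−1)^{|ρ|}·det(WᵀBW)·det kkt K [Q; τ]`.
* §3 [folklore] over `ℝ`: `absDet_gramTransfer` (`|det N|·det(τW)² = |det Φ|·|det M|`), `log_absDet_gramTransfer`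
  (`log|det N| + 2·log|det(τW)| = log|det Φ| + log|det M|`, the 4-slot input of `secondVar_comb_eq_zero`), both in the (R1) and (R2) readings.
NOT HERE (PART 2, on the owner's choice of shape): the curve ∕ jet ∕ polarised versions (`SliceTransferModel` → `SliceTransferJets` →
`SliceTransferJetsMixed` → TA4 pattern) — they consume §3 verbatim.
Provenance: G-an2-4 formalisation swarm leaf seat `b2b-balaban-gan24-formalise-leaf-03` gen 44 (cross-lane), claim «K-TA4G» PART 1, 2026-08-20.
-/

namespace Summit.QuantumFields.BalabanUV.Beta.D1BFx.GramWeightDeterminant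

open Matrix
open Literature.MathematicalPhysics.QuantumFieldTheory.Balaban1983to89.Beta.Composition (kkt)
open Literature.MathematicalPhysics.QuantumFieldTheory.Balaban1983to89.Beta.GaugeFixing (det_kkt_add_weight det_kkt_fromRows_slice_change)

/-! ## §1 Co-frame weight `τ′ᵀ·A·τ′` with the slice change to `τ`, and its Gram read-out -/

section Field

variable {𝕜 : Type*} [Field 𝕜]
variable {ν μ ρ : Type*} [Fintype ν] [Fintype μ] [Fintype ρ] [DecidableEq ν] [DecidableEq μ] [DecidableEq ρ]

/-- [folklore] **CO-FRAME WEIGHT + SLICE CHANGE**: `K·W = 0`, `Kᵀ·W = 0`, `Q·W = 0`, `τW`, `τ′W`, `A` invertible ⟹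
`det kkt (K + τ′ᵀAτ′) Q · det(τW)² = (−1)^{|ρ|}·det A·det(τ′W)²·det kkt K [Q; τ]` (the tree's `det_kkt_add_weight` at the slice `τ′`, then
`det_kkt_fromRows_slice_change` from `τ′` to `τ`). -/
theorem det_kkt_add_weight_slice (K : Matrix ν ν 𝕜) (Q : Matrix μ ν 𝕜) (τ τ' : Matrix ρ ν 𝕜) (W : Matrix ν ρ 𝕜) (A : Matrix ρ ρ 𝕜)
    (hKW : K * W = 0) (hKtW : Kᵀ * W = 0) (hQW : Q * W = 0) (hT : IsUnit (τ * W).det) (hT' : IsUnit (τ' * W).det)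
    (hA : IsUnit A.det) :
    (kkt (K + τ'ᵀ * A * τ') Q).det * (τ * W).det ^ 2
      = (-1) ^ Fintype.card ρ * A.det * (τ' * W).det ^ 2 * (kkt K (fromRows Q τ)).det := by
  have h1 := det_kkt_add_weight K Q τ' W A hKW hQW hT' hA
  have h2 := det_kkt_fromRows_slice_change K Q τ τ' W hKW hKtW hQW hT hT'
  rw [h1]
  linear_combination ((-1 : 𝕜) ^ Fintype.card ρ * A.det) * h2

omit [Fintype μ] [DecidableEq ν] [DecidableEq μ] [DecidableEq ρ] in
/-- [folklore] **GRAM READ-OUT OF A CO-FRAME WEIGHT**: `Wᵀ(τ′ᵀAτ′)W = (τ′W)ᵀ·A·(τ′W)`, hence `det(Wᵀ(τ′ᵀAτ′)W) = det(τ′W)²·det A`. -/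
theorem gram_coframe (τ' : Matrix ρ ν 𝕜) (W : Matrix ν ρ 𝕜) (A : Matrix ρ ρ 𝕜) :
    Wᵀ * (τ'ᵀ * A * τ') * W = (τ' * W)ᵀ * A * (τ' * W) := by
  rw [Matrix.transpose_mul]
  simp only [Matrix.mul_assoc]

omit [Fintype μ] [DecidableEq ν] [DecidableEq μ] in
/-- [folklore] `det(Wᵀ(τ′ᵀAτ′)W) = det(τ′W)²·det A`. -/
theorem det_gram_coframe (τ' : Matrix ρ ν 𝕜) (W : Matrix ν ρ 𝕜) (A : Matrix ρ ρ 𝕜) :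
    (Wᵀ * (τ'ᵀ * A * τ') * W).det = (τ' * W).det ^ 2 * A.det := by
  rw [gram_coframe, det_mul, det_mul, det_transpose]
  ring

/-- [folklore] **CO-FRAME WEIGHT, GRAM CURRENCY**: with `Φ := Wᵀ(τ′ᵀAτ′)W`,
`det kkt (K + τ′ᵀAτ′) Q · det(τW)² = (−1)^{|ρ|}·det Φ·det kkt K [Q; τ]`. -/
theorem det_kkt_add_weight_slice_gram (K : Matrix ν ν 𝕜) (Q : Matrix μ ν 𝕜) (τ τ' : Matrix ρ ν 𝕜) (W : Matrix ν ρ 𝕜)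
    (A : Matrix ρ ρ 𝕜) (hKW : K * W = 0) (hKtW : Kᵀ * W = 0) (hQW : Q * W = 0) (hT : IsUnit (τ * W).det)
    (hT' : IsUnit (τ' * W).det) (hA : IsUnit A.det) :
    (kkt (K + τ'ᵀ * A * τ') Q).det * (τ * W).det ^ 2
      = (-1) ^ Fintype.card ρ * (Wᵀ * (τ'ᵀ * A * τ') * W).det * (kkt K (fromRows Q τ)).det := by
  rw [det_kkt_add_weight_slice K Q τ τ' W A hKW hKtW hQW hT hT' hA, det_gram_coframe]
  ring

/-! ## §2 The frame-free rank-`ρ` form -/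

omit [Fintype μ] [Fintype ρ] [DecidableEq ν] [DecidableEq μ] [DecidableEq ρ] in
/-- [folklore] The Gram of a symmetric weight is symmetric. -/
theorem gram_transpose {B : Matrix ν ν 𝕜} (hB : Bᵀ = B) (W : Matrix ν ρ 𝕜) : (Wᵀ * B * W)ᵀ = Wᵀ * B * W := by
  rw [Matrix.transpose_mul, Matrix.transpose_mul, Matrix.transpose_transpose, hB, Matrix.mul_assoc]

omit [Fintype μ] [DecidableEq ν] [DecidableEq μ] in
/-- [folklore] THE CANONICAL CO-FRAME of a rank-`ρ` weight: `τ′ := Φ⁻¹·Wᵀ·B` (`Φ := WᵀBW`) has `τ′·W = 1`. -/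
theorem coframe_mul_basis {B : Matrix ν ν 𝕜} (W : Matrix ν ρ 𝕜) (hΦ : IsUnit (Wᵀ * B * W).det) :
    (Wᵀ * B * W)⁻¹ * Wᵀ * B * W = 1 := by
  rw [Matrix.mul_assoc ((Wᵀ * B * W)⁻¹ * Wᵀ), Matrix.mul_assoc, ← Matrix.mul_assoc Wᵀ, nonsing_inv_mul _ hΦ]

omit [Fintype μ] [DecidableEq ν] [DecidableEq μ] in
/-- [folklore] … and reproduces the weight: `τ′ᵀ·Φ·τ′ = B·W·Φ⁻¹·Wᵀ·B` (`B`, hence `Φ`, symmetric), `= B` under the rank identity. -/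
theorem coframe_weight {B : Matrix ν ν 𝕜} (hB : Bᵀ = B) (W : Matrix ν ρ 𝕜) (hΦ : IsUnit (Wᵀ * B * W).det)
    (hrank : B * W * (Wᵀ * B * W)⁻¹ * Wᵀ * B = B) :
    ((Wᵀ * B * W)⁻¹ * Wᵀ * B)ᵀ * (Wᵀ * B * W) * ((Wᵀ * B * W)⁻¹ * Wᵀ * B) = B := by
  have hΦt : (Wᵀ * B * W)ᵀ = Wᵀ * B * W := gram_transpose hB W
  have hΦit : ((Wᵀ * B * W)⁻¹)ᵀ = (Wᵀ * B * W)⁻¹ := by rw [transpose_nonsing_inv, hΦt]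
  rw [Matrix.transpose_mul, Matrix.transpose_mul, Matrix.transpose_transpose, hB, hΦit]
  -- `B·(W·Φ⁻¹)·Φ·(Φ⁻¹·Wᵀ·B) = B·W·Φ⁻¹·Wᵀ·B`
  calc B * (W * (Wᵀ * B * W)⁻¹) * (Wᵀ * B * W) * ((Wᵀ * B * W)⁻¹ * Wᵀ * B)
      = B * W * ((Wᵀ * B * W)⁻¹ * (Wᵀ * B * W)) * (Wᵀ * B * W)⁻¹ * Wᵀ * B := by simp only [Matrix.mul_assoc]
    _ = B := by rw [nonsing_inv_mul _ hΦ, Matrix.mul_one, hrank]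

/-- [folklore] **FRAME-FREE RANK-`ρ` FORM**: for a symmetric weight `B` with `Φ := WᵀBW` invertible and the rank identity
`B·W·Φ⁻¹·Wᵀ·B = B` (⟺ `rank B = |ρ|`), the order-0 Ward relations and an invertible comb Gram `τW`:
`det kkt (K + B) Q · det(τW)² = (−1)^{|ρ|}·det(WᵀBW)·det kkt K [Q; τ]` — §1 at the canonical co-frame `τ′ := Φ⁻¹WᵀB`, `A := Φ`. -/
theorem det_kkt_add_rankWeight (K : Matrix ν ν 𝕜) (Q : Matrix μ ν 𝕜) (τ : Matrix ρ ν 𝕜) (W : Matrix ν ρ 𝕜) (B : Matrix ν ν 𝕜)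
    (hB : Bᵀ = B) (hΦ : IsUnit (Wᵀ * B * W).det) (hrank : B * W * (Wᵀ * B * W)⁻¹ * Wᵀ * B = B)
    (hKW : K * W = 0) (hKtW : Kᵀ * W = 0) (hQW : Q * W = 0) (hT : IsUnit (τ * W).det) :
    (kkt (K + B) Q).det * (τ * W).det ^ 2 = (-1) ^ Fintype.card ρ * (Wᵀ * B * W).det * (kkt K (fromRows Q τ)).det := by
  set τ' : Matrix ρ ν 𝕜 := (Wᵀ * B * W)⁻¹ * Wᵀ * B with hτ'
  have h1 : τ' * W = 1 := coframe_mul_basis W hΦ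
  have hT' : IsUnit (τ' * W).det := by rw [h1, det_one]; exact isUnit_one
  have hw : τ'ᵀ * (Wᵀ * B * W) * τ' = B := coframe_weight hB W hΦ hrank
  have h := det_kkt_add_weight_slice K Q τ τ' W (Wᵀ * B * W) hKW hKtW hQW hT hT' hΦ
  rw [hw, h1, det_one, one_pow, mul_one] at h
  exact h

end Field

/-! ## §3 Over `ℝ`: absolute and logarithmic forms (the inputs of the second-variation argument) -/

section Real

variable {ν μ ρ : Type*} [Fintype ν] [Fintype μ] [Fintype ρ] [DecidableEq ν] [DecidableEq μ] [DecidableEq ρ]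

/-- [folklore] From `x · t² = (−1)^k · φ · m` to `|x|·t² = |φ|·|m|`. -/
theorem abs_form_of_det_identity {x t φ m : ℝ} {k : ℕ} (h : x * t ^ 2 = (-1) ^ k * φ * m) : |x| * t ^ 2 = |φ| * |m| := by
  have := congrArg (fun r : ℝ => |r|) h
  simp only [abs_mul, abs_pow, abs_neg, abs_one, one_pow, one_mul] at this
  rwa [sq_abs] at this

/-- [folklore] From `|x|·t² = |φ|·|m|` with `t`, `φ`, `m ≠ 0` to `x ≠ 0` and the logarithmic form
`log|x| + 2·log|t| = log|φ| + log|m|`. -/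
theorem log_form_of_abs_identity {x t φ m : ℝ} (h : |x| * t ^ 2 = |φ| * |m|) (ht : t ≠ 0) (hφ : φ ≠ 0) (hm : m ≠ 0) :
    x ≠ 0 ∧ Real.log |x| + 2 * Real.log |t| = Real.log |φ| + Real.log |m| := by
  have hx : x ≠ 0 := by
    intro h0
    rw [h0, abs_zero, zero_mul] at h
    exact mul_ne_zero (abs_ne_zero.mpr hφ) (abs_ne_zero.mpr hm) h.symm
  refine ⟨hx, ?_⟩
  have hlog := congrArg Real.log h
  rw [Real.log_mul (abs_ne_zero.mpr hx) (pow_ne_zero 2 ht), Real.log_mul (abs_ne_zero.mpr hφ) (abs_ne_zero.mpr hm),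
    ← sq_abs, Real.log_pow] at hlog
  push_cast at hlog
  linarith

/-- [folklore] **(R2) ABSOLUTE FORM**: `|det kkt (K + τ′ᵀAτ′) Q|·det(τW)² = |det(Wᵀ(τ′ᵀAτ′)W)|·|det kkt K [Q; τ]|`. -/
theorem absDet_gramTransfer_coframe (K : Matrix ν ν ℝ) (Q : Matrix μ ν ℝ) (τ τ' : Matrix ρ ν ℝ) (W : Matrix ν ρ ℝ)
    (A : Matrix ρ ρ ℝ) (hKW : K * W = 0) (hKtW : Kᵀ * W = 0) (hQW : Q * W = 0) (hT : (τ * W).det ≠ 0)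
    (hT' : (τ' * W).det ≠ 0) (hA : A.det ≠ 0) :
    |(kkt (K + τ'ᵀ * A * τ') Q).det| * (τ * W).det ^ 2 = |(Wᵀ * (τ'ᵀ * A * τ') * W).det| * |(kkt K (fromRows Q τ)).det| :=
  abs_form_of_det_identity (det_kkt_add_weight_slice_gram K Q τ τ' W A hKW hKtW hQW (isUnit_iff_ne_zero.2 hT)
    (isUnit_iff_ne_zero.2 hT') (isUnit_iff_ne_zero.2 hA))

/-- [folklore] **(R2) LOGARITHMIC FORM** (nondegenerate case `det kkt K [Q; τ] ≠ 0`): `det N ≠ 0` and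
`log|det N| + 2·log|det(τW)| = log|det Φ| + log|det M|`, `N := kkt (K + τ′ᵀAτ′) Q`, `Φ := Wᵀ(τ′ᵀAτ′)W`, `M := kkt K [Q; τ]`. -/
theorem log_absDet_gramTransfer_coframe (K : Matrix ν ν ℝ) (Q : Matrix μ ν ℝ) (τ τ' : Matrix ρ ν ℝ) (W : Matrix ν ρ ℝ)
    (A : Matrix ρ ρ ℝ) (hKW : K * W = 0) (hKtW : Kᵀ * W = 0) (hQW : Q * W = 0) (hT : (τ * W).det ≠ 0)
    (hT' : (τ' * W).det ≠ 0) (hA : A.det ≠ 0) (hM : (kkt K (fromRows Q τ)).det ≠ 0) :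
    (kkt (K + τ'ᵀ * A * τ') Q).det ≠ 0 ∧
      Real.log |(kkt (K + τ'ᵀ * A * τ') Q).det| + 2 * Real.log |(τ * W).det|
        = Real.log |(Wᵀ * (τ'ᵀ * A * τ') * W).det| + Real.log |(kkt K (fromRows Q τ)).det| := by
  have hΦ : (Wᵀ * (τ'ᵀ * A * τ') * W).det ≠ 0 := by
    rw [det_gram_coframe]; exact mul_ne_zero (pow_ne_zero 2 hT') hA
  exact log_form_of_abs_identity (absDet_gramTransfer_coframe K Q τ τ' W A hKW hKtW hQW hT hT' hA) hT hΦ hM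

/-- [folklore] **(R1) ABSOLUTE FORM**: `|det kkt (K + B) Q|·det(τW)² = |det(WᵀBW)|·|det kkt K [Q; τ]|` for a symmetric rank-`ρ` weight. -/
theorem absDet_gramTransfer_rank (K : Matrix ν ν ℝ) (Q : Matrix μ ν ℝ) (τ : Matrix ρ ν ℝ) (W : Matrix ν ρ ℝ) (B : Matrix ν ν ℝ)
    (hB : Bᵀ = B) (hΦ : (Wᵀ * B * W).det ≠ 0) (hrank : B * W * (Wᵀ * B * W)⁻¹ * Wᵀ * B = B)
    (hKW : K * W = 0) (hKtW : Kᵀ * W = 0) (hQW : Q * W = 0) (hT : (τ * W).det ≠ 0) :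
    |(kkt (K + B) Q).det| * (τ * W).det ^ 2 = |(Wᵀ * B * W).det| * |(kkt K (fromRows Q τ)).det| :=
  abs_form_of_det_identity (det_kkt_add_rankWeight K Q τ W B hB (isUnit_iff_ne_zero.2 hΦ) hrank hKW hKtW hQW
    (isUnit_iff_ne_zero.2 hT))

/-- [folklore] **(R1) LOGARITHMIC FORM** (nondegenerate case): `det kkt (K + B) Q ≠ 0` and
`log|det kkt (K + B) Q| + 2·log|det(τW)| = log|det(WᵀBW)| + log|det kkt K [Q; τ]|`. -/
theorem log_absDet_gramTransfer_rank (K : Matrix ν ν ℝ) (Q : Matrix μ ν ℝ) (τ : Matrix ρ ν ℝ) (W : Matrix ν ρ ℝ) (B : Matrix ν ν ℝ)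
    (hB : Bᵀ = B) (hΦ : (Wᵀ * B * W).det ≠ 0) (hrank : B * W * (Wᵀ * B * W)⁻¹ * Wᵀ * B = B)
    (hKW : K * W = 0) (hKtW : Kᵀ * W = 0) (hQW : Q * W = 0) (hT : (τ * W).det ≠ 0) (hM : (kkt K (fromRows Q τ)).det ≠ 0) :
    (kkt (K + B) Q).det ≠ 0 ∧
      Real.log |(kkt (K + B) Q).det| + 2 * Real.log |(τ * W).det|
        = Real.log |(Wᵀ * B * W).det| + Real.log |(kkt K (fromRows Q τ)).det| :=
  log_form_of_abs_identity (absDet_gramTransfer_rank K Q τ W B hB hΦ hrank hKW hKtW hQW hT) hT hΦ hM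

end Real

end Summit.QuantumFields.BalabanUV.Beta.D1BFx.GramWeightDeterminant
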